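import Summits.QuantumFields.YangMills.Theorems.UnitScaleTiltProp7HermiteCornerDataRow
import Literature.MathematicalPhysics.QuantumFieldTheory.Balaban1983to89.B9BackgroundsKLevelV1
import HarnessLib

/-!
# Route `UnitScaleTilt`, crux K1 «MinimiserStabilityRegPr» (stmt-QuantumFields-19200), route-R E′ path (α′), LEMMA-H-curved (design (x2′-corner)), file F-H7b(i) —
# THE CUBE COVER: the support set of a `k`-centre (✓p661714's predicate `∀ ν, y_ν − Q_ν(z) ∈ {−1,0,1,2}`) together with its `±e_μ` neighbours lies in ONE grid cube
# `torusCube c (2B)` with corner on the `B`-grid, for every grid size `B ≥ 4ℓ + 1` dividing the period (`2·(2B) + 2 ≤` period)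

Cell `ym3-torus`, extra width seat `ym-routeR-w4` (g9); row «routeR-w4: F-H7» (★routeR-w1 g5, 2026-08-28 19:44Z).  THEOREMS ONLY (0 `def`, 0 `sorry`); `--supports
stmt-QuantumFields-19200`, count-neutral.  At the member of record `B := bigSide ℓ M_h (K−n) = M_h·L·L^{K−n} ≥ 40·L^{K−n}` and the cube is an index-`(K−n)` cube of
[Balaban1985BackgroundPropagators]'s class p.396 (`IsCube396` with `n′ = 2`) — that step is F-H7b(ii).  YM₃ on T³ is a ladder rung (R3), not the Clay problem; nothing
here claims LEMMA-H-curved, a stub, the crux or the gap.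

WHAT IS PROVED (ns `…Theorems.Prop7LemmaHCurvedCubeCover`; `ℓ = L^k`, `h = (ℓ−1)∕2`, `N = sitesPerDir 0 = sitesPerDir k · ℓ`).
* §1 arithmetic: `sitesPerDir_zero_eq`, `cast_val_add_one_mul` (✓`Params.one_lt_sitesPerDir` by name) (`((a+1).val·ℓ : ZMod N) = (a.val·ℓ : ZMod N) + ℓ` — the coarse-to-fine scaling is additive),
  `coord_eq_label` (`z_ν = (Q_ν(z).val·ℓ + h) + r_ν(z)`, `r_ν < ℓ`), ★ `label_window` (support predicate ⇒ `(Q_ν.val·ℓ) + 2ℓ = (y_ν.val·ℓ) + j·ℓ` in `ZMod N` with `j ≤ 3`).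
* §2 ★★ `exists_gridCube_cover` — for `B` with `4ℓ + 1 ≤ B`, `B ∣ N`, `2(2B) + 2 ≤ N` and every centre `y`: a corner `c` with `B ∣ (c μ).val` (all `μ`) such that every `z` of
  the support set and all its `±e_μ` shifts lie in `torusCube c (2B)` (`(x_ν − c_ν).val < 2B`).  Corner: `c_ν = B·⌊t_ν∕B⌋`, `t_ν = y_ν.val·ℓ + h + (N − (2ℓ+1))`; then
  `x_ν − c_ν = jℓ + r + (t_ν mod B) + {0,1,2} < 4ℓ + B + 1 ≤ 2B`.
HONEST SCOPE.  `ZMod` bookkeeping ([folklore]); the cube class and (3.35) are not touched here.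

References: T. Bałaban, CMP 99 (1985) 389–434 [Balaban1985BackgroundPropagators] (p.396, the cube class); CMP 95 (1984) 17–40 [Balaban1984PropagatorsI] ((1.18) p.20).
-/

noncomputable section

namespace Summit.QuantumFields.YangMills.Theorems.Prop7LemmaHCurvedCubeCover

open Literature.MathematicalPhysics.QuantumFieldTheory.Balaban1983to89
open B9TorusCalculus (torusT torusT_apply torusT_symm_apply)
open B5Eq118OneStroke (iterBlockOf val_iterBlockOf)
open B15DeterminingSets (embIter)
open B9BackgroundsKLevelV1 (torusCube)
open Summit.QuantumFields.YangMills.Theorems.Prop7TentInterpolation (val_embIter)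
open Summit.QuantumFields.YangMills.Theorems.Prop7HermiteCornerDataRow (self_eq_centre_add_offset)

variable {P : Params} {k : ℕ} (hk : k ≤ P.m + P.K)

/-! ## §1 Arithmetic of the two periods -/

include hk in
/-- `N = N_k·ℓ`: the fine period is the coarse period times the block side. [cite: Balaban1984PropagatorsI, (1.18) p.20] -/
theorem sitesPerDir_zero_eq : P.sitesPerDir 0 = P.sitesPerDir k * P.L ^ k := by
  unfold Params.sitesPerDir; rw [Nat.sub_zero, mul_assoc, ← pow_add, Nat.sub_add_cancel hk]

include hk in
/-- **THE COARSE-TO-FINE SCALING IS ADDITIVE**: `((a + 1).val·ℓ : ZMod N) = (a.val·ℓ : ZMod N) + ℓ`. [folklore] -/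
theorem cast_val_add_one_mul (a : ZMod (P.sitesPerDir k)) :
    ((((a + 1).val * P.L ^ k : ℕ)) : ZMod (P.sitesPerDir 0))
      = (((a.val * P.L ^ k : ℕ)) : ZMod (P.sitesPerDir 0)) + ((P.L ^ k : ℕ) : ZMod (P.sitesPerDir 0)) := by
  have hval : (a + 1).val = (a.val + 1) % P.sitesPerDir k := by
    rw [ZMod.val_add, ZMod.val_one_eq_one_mod, Nat.add_mod_mod]
  have hN := sitesPerDir_zero_eq (P := P) hk
  calc ((((a + 1).val * P.L ^ k : ℕ)) : ZMod (P.sitesPerDir 0))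
      = (((((a.val + 1) * P.L ^ k) % P.sitesPerDir 0 : ℕ)) : ZMod (P.sitesPerDir 0)) := by
          rw [hval, hN, Nat.mul_mod_mul_right]
    _ = ((((a.val + 1) * P.L ^ k : ℕ)) : ZMod (P.sitesPerDir 0)) := ZMod.natCast_mod _ _
    _ = _ := by push_cast; ring

include hk in
/-- **A SITE IN BLOCK COORDINATES**: `z_ν = (Q_ν(z).val·ℓ + h) + r_ν(z)` with `r_ν(z) = (z_ν − h).val mod ℓ < ℓ`. [cite: Balaban1984PropagatorsI, (1.18) p.20] -/
theorem coord_eq_label (z : Site P 0) (ν : Fin P.d) :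
    z ν = (((((iterBlockOf k (fun κ => z κ - ((((P.L ^ k - 1) / 2 : ℕ)) : ZMod (P.sitesPerDir 0)))) ν).val * P.L ^ k + (P.L ^ k - 1) / 2 : ℕ)) :
        ZMod (P.sitesPerDir 0))
      + ((((z ν - ((((P.L ^ k - 1) / 2 : ℕ)) : ZMod (P.sitesPerDir 0))).val % P.L ^ k : ℕ)) : ZMod (P.sitesPerDir 0)) := by
  have h := self_eq_centre_add_offset hk z ν
  rw [← ZMod.natCast_zmod_val ((embIter k (iterBlockOf k (fun κ => z κ - ((((P.L ^ k - 1) / 2 : ℕ)) : ZMod (P.sitesPerDir 0))))) ν), val_embIter hk] at h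
  exact h

include hk in
/-- ★ **THE LABEL WINDOW**: under ✓p661714's support predicate at `(y, z)`, in `ZMod N`: `(Q_ν(z).val·ℓ) + 2ℓ = (y_ν.val·ℓ) + j·ℓ` for some `j ≤ 3` (`j = Q_ν − y_ν + 2 ∈ {3,2,1,0}`).
[cite: Balaban1984PropagatorsI, (1.18) p.20] -/
theorem label_window (y : Site P k) (z : Site P 0) (ν : Fin P.d)
    (hz : y ν = (iterBlockOf k (fun κ => z κ - ((((P.L ^ k - 1) / 2 : ℕ)) : ZMod (P.sitesPerDir 0)))) ν - 1
      ∨ y ν = (iterBlockOf k (fun κ => z κ - ((((P.L ^ k - 1) / 2 : ℕ)) : ZMod (P.sitesPerDir 0)))) ν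
      ∨ y ν = (iterBlockOf k (fun κ => z κ - ((((P.L ^ k - 1) / 2 : ℕ)) : ZMod (P.sitesPerDir 0)))) ν + 1
      ∨ y ν = (iterBlockOf k (fun κ => z κ - ((((P.L ^ k - 1) / 2 : ℕ)) : ZMod (P.sitesPerDir 0)))) ν + 2) :
    ∃ j : ℕ, j ≤ 3 ∧
      ((((iterBlockOf k (fun κ => z κ - ((((P.L ^ k - 1) / 2 : ℕ)) : ZMod (P.sitesPerDir 0)))) ν).val * P.L ^ k : ℕ) : ZMod (P.sitesPerDir 0))
          + 2 * ((P.L ^ k : ℕ) : ZMod (P.sitesPerDir 0))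
        = (((y ν).val * P.L ^ k : ℕ) : ZMod (P.sitesPerDir 0)) + (j : ZMod (P.sitesPerDir 0)) * ((P.L ^ k : ℕ) : ZMod (P.sitesPerDir 0)) := by
  set q := (iterBlockOf k (fun κ => z κ - ((((P.L ^ k - 1) / 2 : ℕ)) : ZMod (P.sitesPerDir 0)))) ν with hq
  have φ1 := cast_val_add_one_mul (P := P) hk
  rcases hz with h | h | h | h
  · -- `q = y + 1`
    have e : q = y ν + 1 := by rw [h]; ring
    refine ⟨3, le_rfl, ?_⟩
    rw [e, φ1]; push_cast; ring
  · refine ⟨2, by norm_num, ?_⟩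
    rw [← h]; push_cast; ring
  · -- `y = q + 1`
    refine ⟨1, by norm_num, ?_⟩
    rw [h, φ1]; push_cast; ring
  · -- `y = q + 2 = (q + 1) + 1`
    refine ⟨0, by norm_num, ?_⟩
    have e : y ν = q + 1 + 1 := by rw [h]; ring
    rw [e, φ1, φ1]; push_cast; ring

/-! ## §2 The grid cube containing the support set and its neighbours -/

include hk in
/-- ★★ **THE CUBE COVER**: see the module docstring. [cite: Balaban1985BackgroundPropagators, p.396 (the cube class)] -/
theorem exists_gridCube_cover (B : ℕ) (hB : 4 * P.L ^ k + 1 ≤ B) (hBN : B ∣ P.sitesPerDir 0) (h2B : 2 * (2 * B) + 2 ≤ P.sitesPerDir 0) (y : Site P k) :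
    ∃ c : Site P 0, (∀ μ : Fin P.d, B ∣ (c μ).val) ∧
      ∀ z : Site P 0, (∀ ν : Fin P.d, (y ν = (iterBlockOf k (fun κ => z κ - ((((P.L ^ k - 1) / 2 : ℕ)) : ZMod (P.sitesPerDir 0)))) ν - 1
          ∨ y ν = (iterBlockOf k (fun κ => z κ - ((((P.L ^ k - 1) / 2 : ℕ)) : ZMod (P.sitesPerDir 0)))) ν
          ∨ y ν = (iterBlockOf k (fun κ => z κ - ((((P.L ^ k - 1) / 2 : ℕ)) : ZMod (P.sitesPerDir 0)))) ν + 1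
          ∨ y ν = (iterBlockOf k (fun κ => z κ - ((((P.L ^ k - 1) / 2 : ℕ)) : ZMod (P.sitesPerDir 0)))) ν + 2)) →
        z ∈ torusCube c (2 * B) ∧ ∀ μ : Fin P.d, torusT P 0 μ z ∈ torusCube c (2 * B) ∧ (torusT P 0 μ).symm z ∈ torusCube c (2 * B) := by
  set N := P.sitesPerDir 0 with hNdef
  set ℓ := P.L ^ k with hℓdef
  set hh : ℕ := (P.L ^ k - 1) / 2 with hhdef
  have hℓ1 : 1 ≤ ℓ := Nat.one_le_pow _ _ P.L_pos
  have hBpos : 0 < B := by omega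
  have hN1 : 2 * ℓ + 1 ≤ N := by omega
  -- the corner
  let t : Fin P.d → ℕ := fun μ => (y μ).val * ℓ + hh + (N - (2 * ℓ + 1))
  refine ⟨fun μ => (((B * (t μ / B) : ℕ)) : ZMod N), fun μ => ?_, fun z hz => ?_⟩
  · -- `B ∣ (c μ).val = (B·⌊t∕B⌋) mod N`
    rw [ZMod.val_natCast]
    exact (Nat.dvd_mod_iff hBN).2 (dvd_mul_right _ _)
  · -- the window: `x_ν − c_ν = ((w_ν + e : ℕ) : ZMod N)` with `w_ν ≤ 4ℓ + B − 2`, `e ∈ {0, 1, 2}`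
    have hcorner : ∀ μ : Fin P.d, ((((B * (t μ / B) : ℕ)) : ZMod N))
        = ((((y μ).val * ℓ : ℕ)) : ZMod N) + ((hh : ℕ) : ZMod N) - ((2 * ℓ + 1 : ℕ) : ZMod N) - ((t μ % B : ℕ) : ZMod N) := by
      intro μ
      have e1 : B * (t μ / B) = t μ - t μ % B := by have := Nat.div_add_mod (t μ) B; omega
      have e2 : t μ % B ≤ t μ := Nat.mod_le _ _
      have e3 : ((t μ : ℕ) : ZMod N) = ((((y μ).val * ℓ : ℕ)) : ZMod N) + ((hh : ℕ) : ZMod N) - ((2 * ℓ + 1 : ℕ) : ZMod N) := by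
        have : (((N - (2 * ℓ + 1) : ℕ)) : ZMod N) = -(((2 * ℓ + 1 : ℕ)) : ZMod N) := by
          rw [Nat.cast_sub hN1, ZMod.natCast_self, zero_sub]
        show (((y μ).val * ℓ + hh + (N - (2 * ℓ + 1)) : ℕ) : ZMod N) = _
        push_cast [this]
        ring
      rw [e1, Nat.cast_sub e2, e3]
    have hwin : ∀ ν : Fin P.d, ∃ w : ℕ, w + 2 ≤ 4 * ℓ + B ∧
        z ν - ((((B * (t ν / B) : ℕ)) : ZMod N)) = ((w + 1 : ℕ) : ZMod N) := by
      intro ν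
      obtain ⟨j, hj3, hjeq⟩ := label_window hk y z ν (hz ν)
      set r : ℕ := (z ν - ((((P.L ^ k - 1) / 2 : ℕ)) : ZMod (P.sitesPerDir 0))).val % P.L ^ k with hr
      have hrℓ : r < ℓ := Nat.mod_lt _ (by positivity)
      set ρ : ℕ := t ν % B with hρ
      have hρB : ρ < B := Nat.mod_lt _ hBpos
      refine ⟨j * ℓ + r + ρ, ?_, ?_⟩
      · have : j * ℓ ≤ 3 * ℓ := Nat.mul_le_mul_right _ hj3
        omega
      · rw [coord_eq_label hk z ν, hcorner ν]
        -- both sides are casts of naturals; reduce with the label window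
        have hq : ((((iterBlockOf k (fun κ => z κ - ((((P.L ^ k - 1) / 2 : ℕ)) : ZMod (P.sitesPerDir 0)))) ν).val * P.L ^ k : ℕ) : ZMod N)
            = ((((y ν).val * ℓ : ℕ)) : ZMod N) + (j : ZMod N) * ((ℓ : ℕ) : ZMod N) - 2 * ((ℓ : ℕ) : ZMod N) := by
          rw [← hjeq]; ring
        push_cast at hq ⊢
        rw [hq]
        ring
    -- values from the window
    have hval : ∀ (ν : Fin P.d) (e : ℕ), e ≤ 2 → ∀ w : ℕ, w + 2 ≤ 4 * ℓ + B → (((w + e : ℕ) : ZMod N)).val < 2 * B := by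
      intro ν e he w hw
      rw [ZMod.val_natCast, Nat.mod_eq_of_lt (by omega)]
      omega
    refine ⟨fun ν => ?_, fun μ => ⟨fun ν => ?_, fun ν => ?_⟩⟩
    · obtain ⟨w, hw, he⟩ := hwin ν
      show (z ν - _).val < 2 * B
      rw [he]
      exact hval ν 1 (by norm_num) w hw
    · obtain ⟨w, hw, he⟩ := hwin ν
      show ((torusT P 0 μ z) ν - _).val < 2 * B
      rw [torusT_apply]
      by_cases hνμ : ν = μ
      · subst hνμ
        have e2 : (z.shift ν) ν - ((((B * (t ν / B) : ℕ)) : ZMod N)) = ((w + 2 : ℕ) : ZMod N) := by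
          rw [Site.shift, Function.update_self, add_sub_right_comm, he]; push_cast; ring
        rw [e2]; exact hval ν 2 le_rfl w hw
      · have e2 : (z.shift μ) ν = z ν := by rw [Site.shift, Function.update_of_ne hνμ]
        rw [e2, he]; exact hval ν 1 (by norm_num) w hw
    · obtain ⟨w, hw, he⟩ := hwin ν
      show (((torusT P 0 μ).symm z) ν - _).val < 2 * B
      rw [torusT_symm_apply]
      by_cases hνμ : ν = μ
      · subst hνμ
        have e2 : (z.unshift ν) ν - ((((B * (t ν / B) : ℕ)) : ZMod N)) = ((w + 0 : ℕ) : ZMod N) := by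
          rw [Site.unshift, Function.update_self, sub_right_comm, he]; push_cast; ring
        rw [e2]; exact hval ν 0 (by norm_num) w hw
      · have e2 : (z.unshift μ) ν = z ν := by rw [Site.unshift, Function.update_of_ne hνμ]
        rw [e2, he]; exact hval ν 1 (by norm_num) w hw

end Summit.QuantumFields.YangMills.Theorems.Prop7LemmaHCurvedCubeCover

end
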